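import Literature.IUT.LogThetaLattice.PacketLogVolumesLogLinkArch
import HarnessLib

/-!
# [IUTchIII] Prop. 3.9 (iv)(b) at an archimedean place — SHARPNESS of the admissible class ("sufficiently small"
# is not "of small diameter"): proof-only companion of `PacketLogVolumesLogLinkArch.lean` (abc-iut cell, layer L6)

S. Mochizuki, *Inter-universal Teichmüller theory III*, kurims manuscript (May 2020), Prop. 3.9 (iv)(b) p. 117,
Prop. 1.2 (iii) p. 31, Rmk. 3.9.6 p. 145 ("a coincidence of log-volumes — not of arbitrary regions … but rather —
of certain types of 'sufficiently small' regions"); S. Mochizuki, *Topics in absolute anabelian geometry III*,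
Prop. 5.7 (ii)(c) p. 138 ("Let `A ∈ M(k)` be such that `exp_k(A) ⊆ 𝒪^×_k`, and, moreover, the maps `pr_ℝ` and
`exp_k` induce bijections `A ⥲ pr_ℝ(A)`, `A ⥲ exp_k(A)`. Then `μ^log_k(A) = μ̆^log_k(exp_k(A))`").
[claim: Mochizuki2012, status: disputed] for the [IUTchIII] sentences; the computations are classical.

`PacketLogVolumesLogLinkArch.lean` (abc-iut-w4-d001, p411790) discharges abc-iut-L6-t4's `Prop39iv_b` at one
archimedean place with the admissible class `Adm` = regions of units `S ⊆ 𝒪^× = S¹` whose principal-logarithm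
image lies in `M(k)` AND on which `pr_ℝ = ‖·‖` is injective. THIS FILE records in the kernel that the
injectivity clause — print's "bijection `A ⥲ pr_ℝ(A)`" — is NECESSARY (reading note N-w5d005-1 of the RQ7 audit
by abc-iut-w5-d005, HOME/STATUS 2026-08-25T23:43Z), with the symmetric arc `{e^{iθ} | θ ∈ [−a, a]}` as witness:

* `clog_image_symmArc`, `norm_image_symmSegment`, `radialLogVolume_clog_symmArc` — its principal logarithm is
  the segment `i·[−a, a]`, whose radial projection is `[0, a]`: radial log-volume `log a`;
* `angularLogVolume_symmArc` — its angular log-volume is `log (2a)` (arc length `2a`; L4-t8's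
  `volume_image_coe_addCircle_of_injOn`);
* `clog_image_symmArc_mem_radialAdmissible` — yet `i·[−a, a]` IS a region of the class `M(k)` (nonempty,
  compact, radial projection `[0,a]` the closure of its interior): only the injectivity of `pr_ℝ` fails;
* **`not_prop39iv_b_arch_of_dropped_injOn`** — consequently `Prop39iv_b` with the same carriers, log-volume and
  log-link map but the admissible class WITHOUT the `pr_ℝ`-injectivity clause is FALSE (`a = 1`: `log 1 ≠ log 2`).

So the log-link compatibility of Prop. 3.9 (iv)(b) / Prop. 1.2 (iii) at an archimedean place is a statement about
the regions singled out by [AbsTopIII] Prop. 5.7 (ii)(c), not about all small compact regions of units; consumers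
must not cite `prop39iv_b_arch` for arcs straddling the argument `0`. No new definitions; nothing here bears on
[IUTchIII] Cor. 3.12 or takes a side.
-/

noncomputable section

namespace Literature.IUT.LogThetaLattice

open Set Metric Complex MeasureTheory Literature.AnabelianGeometry.AbsoluteAnabelian
open Literature.AnabelianGeometry.AbsoluteAnabelian.ComplexVolume

/-! ### The symmetric arc `{e^{iθ} | θ ∈ [−a, a]}` and its principal logarithm -/

/-- The principal logarithm of the symmetric arc `{e^{iθ} | θ ∈ [−a, a]}`, `0 ≤ a < π`, is the segment
`i·[−a, a]`. [claim: Mochizuki2012, status: disputed] -/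
theorem clog_image_symmArc {a : ℝ} (ha : a < Real.pi) :
    Complex.log '' ((fun θ : ℝ => Complex.exp (θ * I)) '' Set.Icc (-a) a) =
      (fun θ : ℝ => (θ : ℂ) * I) '' Set.Icc (-a) a := by
  rw [Set.image_image]
  refine Set.image_congr fun θ hθ => ?_
  have him : ((θ : ℂ) * I).im = θ := by simp
  have h1 : -Real.pi < ((θ : ℂ) * I).im := by rw [him]; linarith [hθ.1]
  have h2 : ((θ : ℂ) * I).im ≤ Real.pi := by rw [him]; linarith [hθ.2]
  exact Complex.log_exp h1 h2

/-- The radial projection of the segment `i·[−a, a]` (`0 ≤ a`) is `[0, a]` — `pr_ℝ = ‖·‖` is two-to-one on it.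
[cite: MochizukiAbsTopIII2015, Prop 5.7 (ii)(a) p. 138] -/
theorem norm_image_symmSegment {a : ℝ} (ha : 0 ≤ a) :
    ((‖·‖) '' ((fun θ : ℝ => (θ : ℂ) * I) '' Set.Icc (-a) a) : Set ℝ) = Set.Icc 0 a := by
  rw [Set.image_image]
  have hn : ∀ θ : ℝ, ‖(θ : ℂ) * I‖ = |θ| := fun θ => by
    rw [norm_mul, Complex.norm_I, mul_one, Complex.norm_real, Real.norm_eq_abs]
  ext r
  simp only [Set.mem_image, Set.mem_Icc, hn]
  constructor
  · rintro ⟨θ, ⟨h1, h2⟩, rfl⟩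
    exact ⟨abs_nonneg θ, abs_le.mpr ⟨h1, h2⟩⟩
  · rintro ⟨h0, h1⟩
    exact ⟨r, ⟨by linarith, h1⟩, abs_of_nonneg h0⟩

/-- Hence the radial log-volume of the principal logarithm of the symmetric arc is `log a`.
[cite: MochizukiAbsTopIII2015, Prop 5.7 (ii)(a) p. 138] -/
theorem radialLogVolume_clog_symmArc {a : ℝ} (ha : 0 ≤ a) (ha' : a < Real.pi) :
    radialLogVolume (Complex.log '' ((fun θ : ℝ => Complex.exp (θ * I)) '' Set.Icc (-a) a)) = Real.log a := by
  rw [clog_image_symmArc ha', radialLogVolume, radialVolume, norm_image_symmSegment ha, Real.volume_Icc,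
    sub_zero, ENNReal.toReal_ofReal ha]

/-- … although that principal logarithm `i·[−a, a]` (`0 < a`) IS a region of the class `M(k)` of [AbsTopIII]
Prop. 5.7 (ii): nonempty, compact, radial projection `[0, a]` equal to the closure of its interior — only the
injectivity of `pr_ℝ` fails. [cite: MochizukiAbsTopIII2015, Prop 5.7 (ii) p. 138] -/
theorem clog_image_symmArc_mem_radialAdmissible {a : ℝ} (ha : 0 < a) (ha' : a < Real.pi) :
    Complex.log '' ((fun θ : ℝ => Complex.exp (θ * I)) '' Set.Icc (-a) a) ∈ radialAdmissible := by
  rw [clog_image_symmArc ha']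
  refine ⟨⟨(0 : ℂ) * I, 0, ⟨by linarith, ha.le⟩, by simp⟩, ?_, ?_⟩
  · exact isCompact_Icc.image (Complex.continuous_ofReal.mul continuous_const)
  · rw [norm_image_symmSegment ha.le, interior_Icc, closure_Ioo ha.ne]

/-- The symmetric arc is a region of units. [claim: Mochizuki2012, status: disputed] -/
theorem symmArc_subset_sphere (a : ℝ) :
    (fun θ : ℝ => Complex.exp (θ * I)) '' Set.Icc (-a) a ⊆ sphere (0 : ℂ) 1 := by
  rintro _ ⟨θ, -, rfl⟩
  exact mem_sphere_zero_iff_norm.mpr (Complex.norm_exp_ofReal_mul_I θ)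

/-- The projection of the symmetric arc `{e^{iθ} | θ ∈ [−a, a]}` (`a < π`) to `𝒪^× ≅ ℝ/2πℤ` is the image of
`[−a, a]`. [cite: MochizukiAbsTopIII2015, Prop 5.7 (ii)(a) p. 138] -/
theorem phase_image_symmArc {a : ℝ} (ha : a < Real.pi) :
    phase '' ((fun θ : ℝ => Complex.exp (θ * I)) '' Set.Icc (-a) a) =
      ((↑) : ℝ → AddCircle (2 * Real.pi)) '' Set.Icc (-a) a := by
  rw [Set.image_image]
  refine Set.image_congr fun θ hθ => ?_
  have hθ' : θ ∈ Set.Ioc (-Real.pi) Real.pi := ⟨by linarith [hθ.1], by linarith [hθ.2]⟩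
  show ((Complex.arg (Complex.exp (θ * I)) : ℝ) : AddCircle (2 * Real.pi)) = (θ : AddCircle (2 * Real.pi))
  rw [Complex.exp_mul_I, Complex.arg_cos_add_sin_mul_I hθ']

/-- The quotient map `ℝ → ℝ/2πℤ` is injective on `[−a, a]` when `a < π` (helper). [folklore] -/
private theorem injOn_coe_addCircle_symmIcc {a : ℝ} (ha : a < Real.pi) :
    Set.InjOn ((↑) : ℝ → AddCircle (2 * Real.pi)) (Set.Icc (-a) a) := by
  haveI : Fact (0 < 2 * Real.pi) := ⟨Real.two_pi_pos⟩
  intro x hx y hy h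
  have hx' : x ∈ Set.Ico (-Real.pi) (-Real.pi + 2 * Real.pi) :=
    ⟨by linarith [hx.1], by linarith [hx.2]⟩
  have hy' : y ∈ Set.Ico (-Real.pi) (-Real.pi + 2 * Real.pi) :=
    ⟨by linarith [hy.1], by linarith [hy.2]⟩
  exact (AddCircle.coe_eq_coe_iff_of_mem_Ico hx' hy').mp h

/-- The angular log-volume of the symmetric arc `{e^{iθ} | θ ∈ [−a, a]}`, `0 < a < π`, is `log (2a)` (arc
length `2a`, via abc-iut-L4-t8's `volume_image_coe_addCircle_of_injOn`).
[cite: MochizukiAbsTopIII2015, Prop 5.7 (ii)(a) p. 138] -/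
theorem angularLogVolume_symmArc {a : ℝ} (ha : 0 < a) (ha' : a < Real.pi) :
    angularLogVolume ((fun θ : ℝ => Complex.exp (θ * I)) '' Set.Icc (-a) a) = Real.log (2 * a) := by
  haveI : Fact (0 < 2 * Real.pi) := ⟨Real.two_pi_pos⟩
  rw [angularLogVolume, angularVolume, phase_image_symmArc ha',
    volume_image_coe_addCircle_of_injOn isCompact_Icc (injOn_coe_addCircle_symmIcc ha'), Real.volume_Icc,
    sub_neg_eq_add, ENNReal.toReal_ofReal (by linarith), ← two_mul]

/-! ### The injectivity clause of the admissible class is necessary -/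

open Classical in
/-- **SHARPNESS of `prop39iv_b_arch`** ([IUTchIII] Rmk. 3.9.6 "sufficiently small"; [AbsTopIII] Prop. 5.7 (ii)(c)
"the maps `pr_ℝ` and `exp_k` induce bijections"): with the same carriers `ℂ`, the same log-volume (angular on
regions of units, radial otherwise) and the same log-link map (principal logarithm on the units), but the
admissible class WITHOUT the `pr_ℝ`-injectivity clause — all regions of units whose principal-logarithm image lies
in `M(k)` — abc-iut-L6-t4's `Prop39iv_b` is FALSE: the arc `{e^{iθ} | |θ| ≤ 1}` has angular log-volume `log 2`
while its logarithm `i·[−1, 1]` has radial log-volume `log 1 = 0`. [claim: Mochizuki2012, status: disputed] -/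
theorem not_prop39iv_b_arch_of_dropped_injOn :
    ¬ Prop39iv_b (fun _ _ : ℤ => ℂ)
        (fun _ _ A => if A ⊆ sphere (0 : ℂ) 1 then angularLogVolume A else radialLogVolume A)
        (fun _ _ x => if ‖x‖ = 1 then some (Complex.log x) else none)
        (fun _ _ => {S | S ⊆ sphere (0 : ℂ) 1 ∧ Complex.log '' S ∈ radialAdmissible}) := by
  intro h
  have h1 : (1 : ℝ) < Real.pi := by linarith [Real.two_le_pi]
  set S : Set ℂ := (fun θ : ℝ => Complex.exp (θ * I)) '' Set.Icc (-1) 1 with hS_def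
  have hS : S ⊆ sphere (0 : ℂ) 1 := symmArc_subset_sphere 1
  have hA : Complex.log '' S ∈ radialAdmissible := clog_image_symmArc_mem_radialAdmissible one_pos h1
  have key := h 0 0 S ⟨hS, hA⟩
  dsimp only at key
  rw [lgImage_eq_image_clog hS, if_neg (not_subset_sphere_of_mem_radialAdmissible hA), if_pos hS,
    radialLogVolume_clog_symmArc zero_le_one h1, angularLogVolume_symmArc one_pos h1, Real.log_one,
    mul_one] at key
  exact absurd key.symm (Real.log_pos one_lt_two).ne'

end Literature.IUT.LogThetaLattice

end
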